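import Mathlib
import Literature.Barriers.ValiantsHypothesis.AlgebraicNaturalProofs
import Literature.Computability.AlgebraicComplexity.ArithCircuitProofs
import Summits.ValiantsHypothesis.ValiantsHypothesis.Theorems.BarrierLeverPartitionMinorsHitByVPStratifiedLayouts
import Summits.ValiantsHypothesis.ValiantsHypothesis.Theses.BarrierLever

/-!
# Route BarrierLever — item `PartitionMinorsHitByVP` (stmt-ValiantsHypothesis-19717):
# the STRATA-LEAVES door of record, an infinite TT-irreducible family settled for 19717, and the
# residue typed against the irreducible core of TT (item 19616)

Helper file (`--supports stmt-ValiantsHypothesis-19717`; cell valiant-natproofs, rung V4, 𝒟-side,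
prover seat val-np-p6 gen 0). Definition-free. Closes NO item.

* **`partitionMinorsHitByVP_of_strataLeaves`** — the STRATA-LEAVES CONJECTURE implies item 19717
  VERBATIM with `b = 2c + 4`. Hypothesis: eventually in `h`, every injective layout `(u, w)` admits
  ONE threshold pair `λ, μ : Fin h → ℤ`, row strata `lr i < m ≤ (h+h)^c` and column strata `lc`
  cut out by monotone cuts, an injective matching `π` realised by a permutation `e` of `Fin r`
  (`lc (e i) = π (lr i)`), such that EVERY stratum is a good leaf: SMALL (`≤ (h+h)^c` rows),
  certified by ONE product state (arbitrary complex site tables, `…SplitDoor.leaf_hit`), or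
  AUTOMORPHIC (`w (e i) = σ_t((u i) ∆ s_t)` on stratum `t`). This hypothesis is implied by the
  split-leaves hypothesis of `…SplitDoor.partitionMinorsHitByVP_of_splitLeaves` (p443525: `m = 2`,
  leaves small/product; census h = 3 exhaustive, h ≤ 8 sampled, kit j253355…j253872) and is the
  conjecture of record of this seat; the door behind it (`…StrataDoor.partitionMinor_hit_of_strata`,
  p448281) is ADDITIVE in size, so the number of strata may grow polynomially with `h`.
* **`weightClasses_one_two_hit`** — the family `U = W₁ ∪ W₂` (singletons and pairs),
  `W = W₁ ∪ W_{h−2}`, every `h ≥ 4`: hit inside `SmallCircuits ℂ (h+h) 4`.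

## The residue of the strata door, typed against item 19616

Item 19616 (`TransversalMinorsNonsingularOnIrreducibleLayouts`, planner p1-g10) isolates the
TT-IRREDUCIBLE layouts: no literal-pair split R1 (for every coordinate pair `(a,c)` and bits
`(β,γ)` the classes `{i : (a ∈ u_i) = β}` and `{j : (c ∈ w_j) = γ}` differ in size) and no twin-free
pair R2 (items 19587/19588). The 19717 calculus differs from the TT calculus in two ways.
(1) MORE CUTS. An R1 split is the bi-threshold split with `λ = ±e_a`, `μ = ±e_c`; the strata door
takes ANY integer weights — e.g. the Hamming weight `λ = 𝟙` — and any number of strata. Hence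
TT-irreducible layouts fall: the census examples of kit j253855 (`W₀∪W₁ v W₀∪W₃` at `h = 4`,
`W₁∪W₂ v W₁∪W₃` and `W₁∪W₅ v W₄∪W₅` at `h = 5`) are instances of
`…StrataDoor.partitionMinor_hit_of_weightClasses`, and the family of `weightClasses_one_two_hit`
is TT-irreducible for EVERY `h ≥ 5`: the R1 class sizes are `h` or `(h−1)+C(h−1,2)` on the rows and
`1+C(h−1,2)` or `2h−2` on the columns, and `h = 1+C(h−1,2) ⇔ h = 4`, `h = 2h−2 ⇔ h = 2`,
`(h−1)+C(h−1,2) = 1+C(h−1,2) ⇔ h = 2`, `(h−1)+C(h−1,2) = 2h−2 ⇔ h = 4`, so no R1 for `h ≥ 5`;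
deleting any coordinate `a` merges the rows `{a, b}` and `{b}`, so no R2.
(2) FEWER LEAVES. TT has no size budget, so R1/R2 may recurse to singletons (`2^h` leaves on the
principal full-cube layout); a 19717 witness must have size `(h+h)^b` and the doors are additive,
so exactly the hierarchies with `poly(h)` LEAVES are affordable (depth is free). The TT chain
(19658 ⇒ 19616 ⇒ 19152 ⇒[19153 ✓] 19126 ⇒[19133 ✓] 19717: ONE universal witness of size `O(h^7)`)
therefore remains the door for the random-like middle band `r ≈ 2^{h/2}` (where support-based
adaptive witnesses are dead, memo ADAPTIVE-WITNESSES-MEMO-g6 §1), while the strata door settles the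
symmetric classes — precisely the ones on which the chain's certificate families died and R1/R2 are
silent — directly and unconditionally. RESIDUE OF THIS SEAT'S DOOR = injective layouts all of
whose stratifications into small / product-certified / automorphic cells need super-polynomially
many strata; no member is known (every layout of the censuses has `r ≤ (h+h)^2`, i.e. is a small
leaf — the statement is asymptotic and no finite census bears on it).

WHAT THIS IS NOT: the strata-leaves conjecture is OPEN; the weight-class theorems certify
19717-witnesses, not transversal minors (nothing on 19616/TT itself); nothing on crux 14610 / VP vs VNP.
-/

set_option linter.dupNamespace false

namespace Summit.ValiantsHypothesis.ValiantsHypothesis.Theorems.BarrierLever.StrataDoor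

open Finset
open Literature.Barriers.ValiantsHypothesis Literature.Computability.AlgebraicComplexity
open Summit.ValiantsHypothesis.ValiantsHypothesis.Theorems.BarrierLever.Automorphic
  (twistedDiag_mem_smallCircuits)
open Summit.ValiantsHypothesis.ValiantsHypothesis.Theorems.BarrierLever.SplitDoor
  (leaf_hit smallCircuits_mono)

variable {h r : ℕ}

/-! ## 1. The infinite TT-irreducible family `W₁ ∪ W₂` v `W₁ ∪ W_{h-2}` -/

/-- **`W₁∪W₂ v W₁∪W_{h−2}` is hit** (`h ≥ 4`, `b = 4`): rows = all singletons and pairs, columns =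
all singletons and `(h−2)`-sets. TT-irreducible for `h ≥ 5` (module docstring). -/
theorem weightClasses_one_two_hit (hh : 4 ≤ h) (u w : Fin r → Finset (Fin h))
    (hu : Function.Injective u)
    (hU : ∀ T : Finset (Fin h), (∃ i, u i = T) ↔ (T.card = 1 ∨ T.card = 2))
    (hW : ∀ T : Finset (Fin h), (∃ j, w j = T) ↔ (T.card = 1 ∨ T.card = h - 2)) :
    ∃ f ∈ SmallCircuits ℂ (h + h) 4,
      (Matrix.of fun i j : Fin r => MvPolynomial.coeff
        (∑ a ∈ u i, Finsupp.single (Fin.castAdd h a) 1 +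
          ∑ c ∈ w j, Finsupp.single (Fin.natAdd h c) 1) f).det ≠ 0 := by
  refine partitionMinor_hit_of_weightClasses (by omega) u w hu ({1, 2} : Finset ℕ)
    (fun k => if k = 1 then 1 else h - 2) (fun k hk => ?_) (fun k hk k' hk' hkk => ?_)
    (fun T => by rw [hU T]; simp) (fun T => by
      rw [hW T]
      simp only [Finset.mem_insert, Finset.mem_singleton, exists_eq_or_imp, exists_eq_left,
        if_true]
      rw [if_neg (by norm_num)])
  · simp only [Finset.mem_insert, Finset.mem_singleton] at hk
    rcases hk with rfl | rfl
    · left; simp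
    · right; simp
  · simp only [Finset.mem_insert, Finset.mem_singleton] at hk hk'
    rcases hk with rfl | rfl <;> rcases hk' with rfl | rfl
    · rfl
    · simp at hkk; omega
    · simp at hkk; omega
    · rfl

/-! ## 2. The strata-leaves door of record -/

/-- A good leaf (small, product-certified or automorphic stratum) is hit inside
`SmallCircuits ℂ (h+h) (c+3)` (`h ≥ 4`). -/
theorem stratum_hit (c : ℕ) (hh : 4 ≤ h) (u w : Fin r → Finset (Fin h))
    (hu : Function.Injective u) (hw : Function.Injective w) (lr : Fin r → ℕ)
    (e : Equiv.Perm (Fin r)) (t : ℕ)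
    (hleaf : Fintype.card {i // lr i = t} ≤ (h + h) ^ c ∨
      (∃ P : Fin h → Bool → Bool → ℂ, (Matrix.of fun i i' : {i // lr i = t} =>
        ∏ a : Fin h, P a (decide (a ∈ u i.1)) (decide (a ∈ w (e i'.1)))).det ≠ 0) ∨
      (∃ (σ : Equiv.Perm (Fin h)) (s : Finset (Fin h)),
        ∀ i : {i // lr i = t}, w (e i.1) = (symmDiff (u i.1) s).image σ)) :
    ∃ f ∈ SmallCircuits ℂ (h + h) (c + 3), (Matrix.of fun i i' : {i // lr i = t} =>
      MvPolynomial.coeff (∑ a ∈ u i.1, Finsupp.single (Fin.castAdd h a) 1 +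
        ∑ c ∈ w (e i'.1), Finsupp.single (Fin.natAdd h c) 1) f).det ≠ 0 := by
  classical
  have h1 : 1 ≤ h + h := by omega
  rcases hleaf with hsmall | ⟨P, hP⟩ | ⟨σ, s, hws⟩
  · -- small or product: `leaf_hit` with the column predicate `lr (e⁻¹ j) = t`
    let et : {i // lr i = t} ≃ {j // lr (e.symm j) = t} :=
      e.subtypeEquiv (fun i => by rw [Equiv.symm_apply_apply])
    exact leaf_hit c hh u w hu hw et (Or.inl hsmall)
  · let et : {i // lr i = t} ≃ {j // lr (e.symm j) = t} :=
      e.subtypeEquiv (fun i => by rw [Equiv.symm_apply_apply])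
    exact leaf_hit c hh u w hu hw et (Or.inr ⟨P, hP⟩)
  · exact ⟨_, smallCircuits_mono h1 (by omega) (twistedDiag_mem_smallCircuits (by omega) σ s),
      cell_det_twistedDiag_ne_zero' u w hu lr e t σ s hws⟩

/-- **The strata-leaves conjecture implies item 19717** (`b = 2c + 4`). -/
theorem partitionMinorsHitByVP_of_strataLeaves (c h₀ : ℕ)
    (hstrata : ∀ h : ℕ, h₀ ≤ h → ∀ (r : ℕ) (u w : Fin r → Finset (Fin h)),
      Function.Injective u → Function.Injective w →
      ∃ (m : ℕ) (lam mu : Fin h → ℤ) (lr lc : Fin r → ℕ) (π : ℕ → ℕ) (e : Equiv.Perm (Fin r))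
        (cr cc : ℕ → ℤ),
        m ≤ (h + h) ^ c ∧ (∀ i, lc (e i) = π (lr i)) ∧
        (∀ i j : Fin r, π (lr i) = π (lr j) → lr i = lr j) ∧ (∀ i, lr i < m) ∧
        Monotone cr ∧ Monotone cc ∧
        (∀ i, cr (lr i) < ∑ a ∈ u i, lam a ∧ ∑ a ∈ u i, lam a ≤ cr (lr i + 1)) ∧
        (∀ j, cc (lc j) < ∑ c ∈ w j, mu c ∧ ∑ c ∈ w j, mu c ≤ cc (lc j + 1)) ∧
        ∀ t < m, (Fintype.card {i // lr i = t} ≤ (h + h) ^ c ∨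
          (∃ P : Fin h → Bool → Bool → ℂ, (Matrix.of fun i i' : {i // lr i = t} =>
            ∏ a : Fin h, P a (decide (a ∈ u i.1)) (decide (a ∈ w (e i'.1)))).det ≠ 0) ∨
          (∃ (σ : Equiv.Perm (Fin h)) (s : Finset (Fin h)),
            ∀ i : {i // lr i = t}, w (e i.1) = (symmDiff (u i.1) s).image σ))) :
    Summit.ValiantsHypothesis.ValiantsHypothesis.Theses.BarrierLever.PartitionMinorsHitByVP := by
  classical
  refine ⟨2 * c + 4, max h₀ 4, fun h hh r u w hu hw => ?_⟩
  have hh4 : 4 ≤ h := (le_max_right _ _).trans hh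
  have hh1 : 1 ≤ h := by omega
  obtain ⟨m, lam, mu, lr, lc, π, e, cr, cc, hm, he, hπ, hlr, hcr, hcc, hrow, hcol, hleaves⟩ :=
    hstrata h ((le_max_left _ _).trans hh) r u w hu hw
  -- leaf witnesses
  have hex : ∀ t, ∃ f : MvPolynomial (Fin (h + h)) ℂ, t < m →
      (f ∈ SmallCircuits ℂ (h + h) (c + 3) ∧ (Matrix.of fun i i' : {i // lr i = t} =>
        MvPolynomial.coeff (∑ a ∈ u i.1, Finsupp.single (Fin.castAdd h a) 1 +
          ∑ c ∈ w (e i'.1), Finsupp.single (Fin.natAdd h c) 1) f).det ≠ 0) := by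
    intro t
    by_cases ht : t < m
    · obtain ⟨f, hf, hd⟩ := stratum_hit c hh4 u w hu hw lr e t (hleaves t ht)
      exact ⟨f, fun _ => ⟨hf, hd⟩⟩
    · exact ⟨0, fun h' => absurd h' ht⟩
  choose F hF using hex
  obtain ⟨f, hdeg, hsize, hne⟩ := partitionMinor_hit_of_strata_perm m u w lam mu lr lc π e he hπ hlr
    cr cc hcr hcc hrow hcol F (fun t ht => (hF t ht).2)
  refine ⟨f, ⟨?_, ?_⟩, hne⟩
  · exact hdeg.trans (Finset.sup_le fun t ht => (hF t (Finset.mem_range.mp ht)).1.1)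
  · refine hsize.trans ?_
    calc ∑ t ∈ Finset.range m, complexity (F t) + m * (h + h + 2)
        ≤ ∑ _t ∈ Finset.range m, (h + h) ^ (c + 3) + m * (h + h + 2) := by
          gcongr with t ht
          exact (hF t (Finset.mem_range.mp ht)).1.2
      _ = m * ((h + h) ^ (c + 3) + (h + h) + 2) := by
          rw [Finset.sum_const, Finset.card_range, smul_eq_mul]; ring
      _ ≤ (h + h) ^ (c + (c + 3) + 1) := strata_budget c (c + 3) m hh1 (by omega) hm
      _ = (h + h) ^ (2 * c + 4) := by ring_nf

end Summit.ValiantsHypothesis.ValiantsHypothesis.Theorems.BarrierLever.StrataDoor
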